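import Mathlib.Data.Finset.Sort
import Mathlib.Data.Real.Basic
import Literature.Computability.MetaComplexity.PolynomialCalculusCNF
import Literature.Computability.MetaComplexity.ScopeExpansion
import HarnessLib

/-!
# The graph functional pigeonhole principle and its polynomial-calculus degree lower bound (named fact)

Mikša–Nordström (CCC 2015) prove a PC degree lower bound for the FUNCTIONAL pigeonhole principle
over bipartite boundary expanders — the second printed INPUT of the "indirect route" to Res(⊕)
width/space lower bounds (Gryaznov–Ovcharov–Riazanov 2024, Thm 10 = this theorem, Thm 11;
Efremenko–Garlík–Itsykson 2024, §1.1.1).  This file TYPES their objects and states their Theorem 4.9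
as a named fact (not proved here):

* a bipartite graph `G = (U ⊔ V, E)` with `U = Fin m` (pigeons) and `V = Fin n` (holes) is given by
  its left neighbourhoods `N : Fin m → Finset (Fin n)`; its boundary expansion is the tree's
  `IsBoundaryExpander` (`ScopeExpansion.lean`: every set of `≤ s` pigeons has `≥ δ` unique-neighbour
  holes per pigeon) applied to the scopes `FPHP.holeScope N u = N u ⊆ ℕ` — MN15 Def. 4.1;
* `FPHP.var n u v = u·n + v` — the variable `x_{u,v}` (the numbering of `pigeonholeCNF`);
* `FPHP.fphpCNF N : CNF ℕ` — MN15's `FPHP_G`: pigeon axioms (4.2a) `⋁_{v ∈ N(u)} x_{u,v}`, hole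
  axioms (4.2b) `¬x_{u,v} ∨ ¬x_{u',v}` (`u < u'` both adjacent to `v`), functionality axioms (4.2c)
  `¬x_{u,v} ∨ ¬x_{u,v'}` (`v < v'` in `N(u)`);
* `MiksaNordstrom2015_PC_FPHP_degree` — NAMED FACT, MN15 Thm 4.9: over a bipartite
  `(s, δ)`-boundary expander with left degrees `≤ d`, `FPHP_G` has no PC refutation (any field) of
  degree `≤ δs/(2d)`.

## Sources (held copy `paper:url-a58eeb96befb` = LIPIcs.CCC.2015.467, DROPS)

* M. Mikša, J. Nordström, *A generalized method for proving polynomial calculus degree lower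
  bounds*, CCC 2015, LIPIcs 33 [MiksaNordstrom2015]: §2 (PC/PCR, "for all fields F regardless of
  characteristic"), Def. 4.1 p. 480 (bipartite boundary expander, boundary = unique-neighbour holes),
  (4.2a)–(4.2d) p. 481 (the clauses; "FPHP_G contains the clauses of PHP_G and in addition clauses
  (4.2c)"), Theorem 4.9 p. 483 (verbatim: "Suppose that G = (U ⊔ V, E) is a bipartite
  (s, δ)-boundary expander with left degree bounded by d. Then it holds that refuting FPHP_G in
  polynomial calculus requires degree strictly greater than δs/(2d).").
* S. Gryaznov, S. Ovcharov, A. Riazanov, ACM ToCT (2024), Thm 10 (the same statement quoted),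
  Thm 11 (`Space(FPHP^{n+1}_n) = Ω(n)`) [GryaznovOvcharovRiazanov2024].

## Design notes

* Implicit hypotheses of print made explicit: `1 ≤ s`, `0 < δ`, `1 ≤ d` (with `s = 0` the
  expansion hypothesis is vacuous and the displayed sentence fails for a pigeon without holes, whose
  pigeon axiom is the empty clause; `d` divides).  With them every pigeon has a hole
  (`exists_mem_of_isBoundaryExpander`).  "degree `> δs/(2d)` is required" for an integer degree
  bound `k` reads: no refutation inside degree `k` whenever `(k : ℝ) ≤ δ s / (2 d)`.
* PC = the tree's `PC.DerivableInDegree` (Krajíček PC/F, product by an arbitrary polynomial inside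
  the degree; same degree strength as MN15's PC); clauses via `PC.ofCNF` (Krajíček (6.0.1)).
  ENCODING/READING (referee W-A329-1): (i) MN15 Def. 2.1 (arXiv p. 5) translates a clause to the
  PCR monomial `∏_{x ∈ L⁺} x · ∏_{y ∈ L⁻} ȳ`, i.e. in PC a POSITIVE literal becomes the variable `x`,
  whereas Krajíček's (6.0.1) (`PC.ofLiteral`) sends a positive literal to `1 − x`; the two
  translations are conjugate under the degree-preserving affine substitution `x ↦ 1 − x` on all
  variables, which fixes the Boolean axioms `x² − x` (`(1−x)² − (1−x) = x² − x`), so degree lower bounds transfer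
  verbatim between them; (ii) MN15 state the bound for "polynomial calculus" and prove it for PCR as
  well (every PC refutation is a PCR refutation of the same degree); the fact typed here is the PC
  reading (the weaker system, hence the formally weaker — implied — statement).
* Not here: PHP_G / Onto versions ((4.2d)), MN15's general framework (Thm 3.x), Thm 4.2/4.4, the
  size corollary `exp(Ω(n))`, the restriction `FPHP^{n+1}_n ↾ρ_G = FPHP_G`.
-/

noncomputable section

namespace Literature.Computability.MetaComplexity

open Literature.Computability.Complexity

namespace FPHP

variable {m n : ℕ}

/-- The variable `x_{u,v}` ("pigeon `u` sits in hole `v`"): `u·n + v`, as for `pigeonholeCNF`.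
[Mikša–Nordström 2015, §4.2 ("variables {x_{u,v} | (u,v) ∈ E}")] [cite: MiksaNordstrom2015, §4.2] -/
def var (n : ℕ) (u : Fin m) (v : Fin n) : ℕ := u * n + v

/-- The hole scope of pigeon `u`: its neighbourhood `N(u) ⊆ V`, as a set of naturals (for the
tree's `IsBoundaryExpander`). [Mikša–Nordström 2015, Def. 4.1] [cite: MiksaNordstrom2015, Def. 4.1] -/
def holeScope (N : Fin m → Finset (Fin n)) (u : Fin m) : Finset ℕ := (N u).map Fin.valEmbedding

/-- The hole scope has `|N(u)|` elements. [folklore] -/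
theorem card_holeScope (N : Fin m → Finset (Fin n)) (u : Fin m) : (holeScope N u).card = (N u).card :=
  Finset.card_map _

variable (N : Fin m → Finset (Fin n))

/-- Pigeon axiom (4.2a): `⋁_{v ∈ N(u)} x_{u,v}` (holes in increasing order).
[Mikša–Nordström 2015, (4.2a)] [cite: MiksaNordstrom2015, (4.2a)] -/
def pigeonClause (u : Fin m) : Clause ℕ :=
  ((N u).sort (· ≤ ·)).map fun v => (var n u v, true)

/-- Hole axioms (4.2b) at hole `v`: `¬x_{u,v} ∨ ¬x_{u',v}` for `u < u'` both adjacent to `v`.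
[Mikša–Nordström 2015, (4.2b)] [cite: MiksaNordstrom2015, (4.2b)] -/
def holeClauses : CNF ℕ :=
  (List.finRange n).flatMap fun v => (List.finRange m).flatMap fun u =>
    (List.finRange m).flatMap fun u' =>
      if u < u' ∧ v ∈ N u ∧ v ∈ N u' then [[(var n u v, false), (var n u' v, false)]] else []

/-- Functionality axioms (4.2c) at pigeon `u`: `¬x_{u,v} ∨ ¬x_{u,v'}` for `v < v'` in `N(u)`.
[Mikša–Nordström 2015, (4.2c)] [cite: MiksaNordstrom2015, (4.2c)] -/
def functionalityClauses : CNF ℕ :=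
  (List.finRange m).flatMap fun u => (List.finRange n).flatMap fun v =>
    (List.finRange n).flatMap fun v' =>
      if v < v' ∧ v ∈ N u ∧ v' ∈ N u then [[(var n u v, false), (var n u v', false)]] else []

/-- **MN15's graph functional pigeonhole principle `FPHP_G`**: pigeon, hole and functionality
axioms of the bipartite graph with left neighbourhoods `N`. [Mikša–Nordström 2015, §4.2 ("FPHP_G
contains the clauses of PHP_G and in addition clauses (4.2c)")] [cite: MiksaNordstrom2015, §4.2] -/
def fphpCNF : CNF ℕ :=
  (List.finRange m).map (pigeonClause N) ++ holeClauses N ++ functionalityClauses N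

/-- A pigeon axiom has `|N(u)|` literals. [folklore] -/
theorem length_pigeonClause (u : Fin m) : (pigeonClause N u).length = (N u).card := by
  rw [pigeonClause, List.length_map, Finset.length_sort]

/-- Hole axioms have two literals. [folklore] -/
theorem length_of_mem_holeClauses {C : Clause ℕ} (hC : C ∈ holeClauses N) : C.length = 2 := by
  simp only [holeClauses, List.mem_flatMap, List.mem_finRange, true_and] at hC
  obtain ⟨v, u, u', hC⟩ := hC
  split_ifs at hC
  · rw [List.mem_singleton] at hC; rw [hC]; rfl
  · simp at hC

/-- Functionality axioms have two literals. [folklore] -/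
theorem length_of_mem_functionalityClauses {C : Clause ℕ} (hC : C ∈ functionalityClauses N) :
    C.length = 2 := by
  simp only [functionalityClauses, List.mem_flatMap, List.mem_finRange, true_and] at hC
  obtain ⟨u, v, v', hC⟩ := hC
  split_ifs at hC
  · rw [List.mem_singleton] at hC; rw [hC]; rfl
  · simp at hC

/-- Clause widths of `FPHP_G`: at most `max d 2` when the left degrees are `≤ d`.
[Mikša–Nordström 2015, §4.2] [folklore] -/
theorem isWidthLE_fphpCNF {d : ℕ} (hdeg : ∀ u, (N u).card ≤ d) : (fphpCNF N).IsWidthLE (max d 2) := by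
  intro C hC
  rcases List.mem_append.1 hC with hC | hC
  · rcases List.mem_append.1 hC with hC | hC
    · obtain ⟨u, -, rfl⟩ := List.mem_map.1 hC
      rw [length_pigeonClause]
      exact (hdeg u).trans (le_max_left _ _)
    · rw [length_of_mem_holeClauses N hC]; exact le_max_right _ _
  · rw [length_of_mem_functionalityClauses N hC]; exact le_max_right _ _

/-- In a bipartite `(s, δ)`-boundary expander with `s ≥ 1`, `δ > 0` every pigeon has a hole.
[Mikša–Nordström 2015, Def. 4.1] [folklore] -/
theorem exists_mem_of_isBoundaryExpander {s δ : ℝ} (h : IsBoundaryExpander (holeScope N) s δ)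
    (hs : 1 ≤ s) (hδ : 0 < δ) (u : Fin m) : (N u).Nonempty := by
  classical
  have hU := h {u} (by simpa using hs)
  rw [Finset.card_singleton, Nat.cast_one, mul_one] at hU
  have hpos : 0 < (boundary (holeScope N) {u}).card := by exact_mod_cast hδ.trans_le hU
  obtain ⟨v, hv⟩ := Finset.card_pos.1 hpos
  have hv' := boundary_subset_cover _ hv
  rw [mem_cover] at hv'
  obtain ⟨u', hu', hvu'⟩ := hv'
  rw [Finset.mem_singleton] at hu'
  subst hu'
  rw [holeScope, Finset.mem_map] at hvu'
  obtain ⟨w, hw, -⟩ := hvu'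
  exact ⟨w, hw⟩

end FPHP

/-! ### The degree lower bound (named fact) -/

/-- NAMED FACT — **Mikša–Nordström's PC degree lower bound for the graph functional pigeonhole
principle** (CCC 2015, Theorem 4.9, verbatim: "Suppose that G = (U ⊔ V, E) is a bipartite
(s, δ)-boundary expander with left degree bounded by d. Then it holds that refuting FPHP_G in
polynomial calculus requires degree strictly greater than δs/(2d)."; PC over any field, §2).  Lean
statement: for every field `F`, all `m n`, every bipartite graph `N : Fin m → Finset (Fin n)` whose
hole scopes form an `(s, δ)`-boundary expander (the tree's `IsBoundaryExpander`) with `s ≥ 1`,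
`δ > 0` (implicit in print), left degrees `≤ d` with `d ≥ 1`, and every `k` with `k ≤ δs/(2d)`, the
Krajíček translation of `FPHP_G` has no PC/F refutation all of whose lines have degree `≤ k`.
Used (as hypothesis) by the Res(⊕) rail `Summits/PneNP/PneNP/Theorems/ReslinSizeFromWidthPCDegreeFPHP.lean`
(Gryaznov–Ovcharov–Riazanov 2024, Thm 10/11 shape). [Mikša–Nordström 2015, Thm 4.9]
[cite: MiksaNordstrom2015, Theorem 4.9] -/
def MiksaNordstrom2015_PC_FPHP_degree : Prop :=
  ∀ (F : Type) [Field F] (m n : ℕ) (N : Fin m → Finset (Fin n)) (s δ : ℝ) (d : ℕ),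
    1 ≤ s → 0 < δ → 1 ≤ d → (∀ u, (N u).card ≤ d) →
      IsBoundaryExpander (FPHP.holeScope N) s δ →
        ∀ k : ℕ, (k : ℝ) ≤ δ * s / (2 * d) → ¬ PC.RefutableInDegree (PC.ofCNF F (FPHP.fphpCNF N)) k

/-- Unfolded form at one field, one expander and one degree bound. [Mikša–Nordström 2015, Thm 4.9]
[cite: MiksaNordstrom2015, Theorem 4.9] -/
theorem MiksaNordstrom2015_PC_FPHP_degree.not_refutable (h : MiksaNordstrom2015_PC_FPHP_degree)
    (F : Type) [Field F] {m n : ℕ} (N : Fin m → Finset (Fin n)) {s δ : ℝ} {d : ℕ} (hs : 1 ≤ s)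
    (hδ : 0 < δ) (hd : 1 ≤ d) (hdeg : ∀ u, (N u).card ≤ d)
    (hG : IsBoundaryExpander (FPHP.holeScope N) s δ) {k : ℕ} (hk : (k : ℝ) ≤ δ * s / (2 * d)) :
    ¬ PC.RefutableInDegree (PC.ofCNF F (FPHP.fphpCNF N)) k :=
  h F m n N s δ d hs hδ hd hdeg hG k hk

end Literature.Computability.MetaComplexity
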